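/-
Copyright: statement-level skeleton of a published paper (lit-balaban cell, Phase-2 proof seat p39 gen 5). No proof claims
beyond what the kernel checks below.
-/
import Literature.MathematicalPhysics.QuantumFieldTheory.Balaban1983to89.B3Bound316
import Literature.MathematicalPhysics.QuantumFieldTheory.Balaban1983to89.B3CxiTorusDerivativeBound

/-!
# B3 — T. Bałaban, *(Higgs)₂,₃ quantum fields in a finite volume. III. Renormalization*, CMP **88** (1983) 411–445
[Balaban1983Higgs3], p. 439 [PDF 29]: **"the expression in the square bracket in (3.23) containing the second term will be
convergent"** — PROVED in `d = 3` on the torus calculus, uniformly in the lattice spacing and in the volume, from the printed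
kernel bounds; and the MODEL INSTANCE with both propagators the torus free propagator `C^ξ_T`, hypothesis-free

statement-level skeleton of published theorems with citation tags; proofs where landed; nothing here is a claim about
the Yang–Mills mass gap

PDF held: `paper:balaban1983-higgs-2-3-quantum-fields-finite-volume` (journal page = PDF page + 410); p. 439 [PDF 29] read in the
OCR text (`p0029.txt`), p. 437 [PDF 27] (`p0027.txt`) for the kernel bounds it refers to ("using the same method as in (3.16)").
Row **B3.Eq3.21-3.24** of `HOME/lit-balaban-r15/ROWS-B3.md` (fold owner r15): the bracket of (3.23) and its p. 439 splitting are
r15's `B3Sect3ScalarSelfEnergy.bracket323` / `bracket323_split` (p245397), whose docstring records *"the convergence claims are not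
typed"* — THIS FILE proves the convergence claim for the second term.

THE PRINTED TEXT (verbatim, p. 439).  *"we sum over proper orderings and j-indices and we get
Σ_{μ=1}^d Σ_x η^dφ(x)·[q²Σ_{x′}η^d(∂^η_μG^η_{j″}(0))(x,x′)g(x)G^η_{j″}(x,x′)g′(x′)](∂^η_μφ′)(x). (3.23)
Further if we take g′(x′) = g′(x) + ((g′(x′) − g′(x))/|x′ − x|)|x′ − x|, then the expression in the square bracket in (3.23)
containing the second term will be convergent and the expression with the first term is equal to
q²g(x)g′(x)Σ_{x′}η^d(∂^η_μG^η_{j″}(0))(x,x′)G^η_{j″}(x,x′). Rescaling from the η-lattice to the L^{−j″}-lattice and using the same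
method as in (3.16) we get some convergent expressions plus q²g(x)g′(x)Σ_{x′}ξ^d(∂^ξ_μC^ξ)(x − x′)C^ξ(x − x′)."*; p. 437: *"Using the
inequalities |C^ξ(y − y′)| ≦ O(1)e^{−½|y−y′|}/|y − y′|, |G^ξ_{j″}(0; y, y′)| ≦ O(1)e^{−δ₀|y−y′|}/|y − y′|, and the corresponding
inequalities for derivatives, we can estimate (3.16) by a constant."*

WHAT IS PROVED, and how (`d = 3`, the dimension in which p. 437 writes the singularities; the ξ-lattice = r15's torus `Site P j`
with spacing symbol `ξ` and volume element `ξ^d`, exactly the carrier of p20's `B3Bound316`).  The SECOND TERM of the p. 439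
splitting (`bracket323_split`) is `S₂(y) = Σ_{y′}ξ^d(∂^ξ_μG^ξ_{j″}(0))(y,y′)g(y)G^ξ_{j″}(y,y′)(g′(y′) − g′(y))`
(`(∂^ξ_μG)(y,y′)` = r15's `d1Kernel ξ⁻¹ μ G`).  **`abs_second323_le`**: if, with `|y − y′| = ξ|y − y′|_∞`
(`LatticeFieldCalculus.supDist`) and one decay rate `δ`, the differentiated resummed free propagator obeys
`|(∂^ξ_μG^ξ_{j″}(0))(y,y′)| ≤ B′e^{−δ|y−y′|}/|y−y′|²` (`y′ ≠ y`; the reading of *"the corresponding inequalities for derivatives"*),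
the second propagator `|G^ξ_{j″}(y,y′)| ≤ Be^{−δ|y−y′|}/|y−y′|` (`y′ ≠ y`), the localization function `|g| ≤ 1`, and `g′` is
LIPSCHITZ on the lattice, `|g′(y′) − g′(y)| ≤ K·ξ|y − y′|₁` (the reading of the printed insertion `(g′(x′) − g′(x))/|x′ − x| · |x′ − x|`:
a bounded difference quotient times the distance), then for EVERY `y`
`|S₂(y)| ≤ d·B′·B·K·radialConst d δ ξ 0` (`radialConst d δ ξ 0 = 2d·3^{d−1}(ξ + 2/δ)`, p20's constant of the radial Riemann sum
`Σ_{y′≠y}ξ³e^{−δ|y−y′|}/|y−y′|²`) — a constant independent of `y` and OF THE VOLUME, monotone in `ξ`, hence ONE constant for all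
spacings `0 < ξ ≤ 1` (**`abs_second323_le_uniform`**): the printed *"will be convergent"*.  Mechanism (kernel-checked, = p. 439's):
the distance factor `|y − y′|` cancels one power of the singularity `1/|y−y′|³` of `(∂G(0))·G`, leaving the integrable `1/|y−y′|²`
(`B3TorusRadialSums.riemann_radial_sum_le`, `κ = 2`); the diagonal term `y′ = y` vanishes with `g′(y) − g′(y) = 0`.
**`abs_bracket323_sub_first_le`**: the same bound for `[(3.23)](y) − g(y)g′(y)Σ_{y′}ξ^d(∂^ξ_μG^ξ_{j″}(0))(y,y′)G^ξ_{j″}(y,y′)`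
(r15's `bracket323` minus the printed first term, by `bracket323_split`).
§3 MODEL INSTANCE, hypothesis-free in the propagators: both propagators the torus free propagator `C^ξ_T` of p03
(`B3CxiTorusBound.CxiT`; the leading term of the print's replacement `G^ξ_{j″}(0) = C^ξ + G^ξ_{j″}(0)(1 − m² − aP)C^ξ`), `d = 3`,
`0 < ξ ≤ 1`, side `ξN ≥ 1`: the derivative bound is this seat's `B3CxiTorusDerivativeBound.abs_d1Kernel_CxiT_le'` (`B′ = 3037500`,
rate ½) and the kernel bound is p03's `CxiT_hC` (`B = torusConst`, rate ½), whence **`abs_second323_CxiT_le`**: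
`|S₂(y)| ≤ 3·3037500·torusConst·K·radialConst 3 ½ ξ 0` and its `ξ ≤ 1`-uniform form.
HONEST SCOPE: `d = 3` only (p. 437's `1/|y − y′|` laws; `d = 2` not treated); the kernel bounds on `G^ξ_{j″}(0)`, `G^ξ_{j″}` in an
external field are HYPOTHESES in §2 (rows B3.Eq2.10–2.12 / [Balaban1982Higgs1] Props. 2.1, 2.3, not claimed) and are discharged in
§3 only for `C^ξ_T`; the Lipschitz form of `g′` is the stated reading; the FIRST term (the `C^ξC^ξ` sum (3.24), r15/p03
`B3Eq324Parseval`) and the *"some convergent expressions"* of the replacement are not treated here.  Mathlib + the cited tree files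
only; theorems only, no new definitions, no named facts; standard axioms.  Unit `lit-balaban-p39-g5` (Phase-2 proof seat p39,
gen 5), HOME `run/shared/lean/pub/lit-balaban/`, 2026-08-21.
-/

open scoped BigOperators

namespace Literature.MathematicalPhysics.QuantumFieldTheory.Balaban1983to89.B3Bound323

open LatticeFieldCalculus B3Sect3ScalarSelfEnergy B3TorusRadialSums B3Bound316 B3CxiTorusBound B3CxiTorusDerivativeBound

noncomputable section

variable {P : Params} {j : ℕ}

/-! ## 1. The per-site estimate off the diagonal -/

/-- kernel: the per-site estimate of the summand of the second term of (3.23) off the diagonal — the distance factor carried by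
`g′(y′) − g′(y)` cancels one power of the singularity of `(∂G(0))·G`. [cite: Balaban1983Higgs3, (3.23) p.439] -/
private theorem term323_le {ξ : ℝ} (hξ : 0 < ξ) {δ B B' K : ℝ} (hδ : 0 < δ) (hB : 0 ≤ B) (hB' : 0 ≤ B') (hK : 0 ≤ K)
    (G0 G : Kernel P j) (g g' : SiteField P j ℝ) (μ : Fin P.d) (y y' : Site P j) (hne : y' ≠ y)
    (hM : |d1Kernel ξ⁻¹ μ G0 y y'| ≤ B' * ((ξ * supDist y y') ^ 2)⁻¹ * Real.exp (-(δ * (ξ * supDist y y'))))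
    (hG : |G y y'| ≤ B * (ξ * supDist y y')⁻¹ * Real.exp (-(δ * (ξ * supDist y y'))))
    (hg : |g y| ≤ 1) (hg' : |g' y' - g' y| ≤ K * (ξ * Site.tdist y y')) :
    |ξ ^ P.d * (d1Kernel ξ⁻¹ μ G0 y y' * g y * G y y' * (g' y' - g' y))|
      ≤ P.d * B' * B * K * (ξ ^ P.d * (((ξ * supDist y y') ^ 2)⁻¹ * Real.exp (-(δ * (ξ * supDist y y'))))) := by
  set sN : ℕ := supDist y y' with hsN
  have hs1 : 1 ≤ sN := by
    by_contra h0
    exact hne (((supDist_eq_zero_iff y y').mp (by omega)).symm)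
  set r : ℝ := ξ * (sN : ℝ) with hr
  have hr0 : 0 < r := mul_pos hξ (by exact_mod_cast hs1)
  set e : ℝ := Real.exp (-(δ * r)) with he
  have he0 : 0 < e := Real.exp_pos _
  have he1 : e ≤ 1 := by
    rw [he, ← Real.exp_zero]; exact Real.exp_le_exp.mpr (by nlinarith [hr0.le, hδ.le])
  -- the Lipschitz factor in terms of the sup distance: `ξ|y − y′|₁ ≤ d·r`
  have hdx' : |g' y' - g' y| ≤ K * (P.d * r) := by
    refine hg'.trans (mul_le_mul_of_nonneg_left ?_ hK)
    have h1 : (Site.tdist y y' : ℝ) ≤ P.d * sN := by exact_mod_cast tdist_le_mul_supDist y y'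
    calc ξ * (Site.tdist y y' : ℝ) ≤ ξ * (P.d * sN) := mul_le_mul_of_nonneg_left h1 hξ.le
      _ = P.d * r := by rw [hr]; ring
  have hM0 : 0 ≤ B' * (r ^ 2)⁻¹ * e := by positivity
  have hG0 : 0 ≤ B * r⁻¹ * e := by positivity
  -- the product of the four factor bounds
  have hprod : |ξ ^ P.d * (d1Kernel ξ⁻¹ μ G0 y y' * g y * G y y' * (g' y' - g' y))|
      ≤ ξ ^ P.d * ((B' * (r ^ 2)⁻¹ * e) * 1 * (B * r⁻¹ * e) * (K * (P.d * r))) := by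
    rw [abs_mul, abs_of_nonneg (by positivity : (0:ℝ) ≤ ξ ^ P.d), abs_mul, abs_mul, abs_mul]
    refine mul_le_mul_of_nonneg_left ?_ (by positivity)
    have h1 := hM; have h2 := hg; have h3 := hG; have h4 := hdx'
    gcongr
  -- algebra: `r⁻¹·r = 1`, then `e² ≤ e`
  have hrr : r⁻¹ * r = 1 := inv_mul_cancel₀ hr0.ne'
  have hrew : ξ ^ P.d * ((B' * (r ^ 2)⁻¹ * e) * 1 * (B * r⁻¹ * e) * (K * (P.d * r)))
      = (P.d * B' * B * K * (ξ ^ P.d * ((r ^ 2)⁻¹ * e))) * e := by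
    calc ξ ^ P.d * ((B' * (r ^ 2)⁻¹ * e) * 1 * (B * r⁻¹ * e) * (K * (P.d * r)))
        = (P.d * B' * B * K * (ξ ^ P.d * ((r ^ 2)⁻¹ * e))) * e * (r⁻¹ * r) := by ring
      _ = _ := by rw [hrr, mul_one]
  have hmain : 0 ≤ P.d * B' * B * K * (ξ ^ P.d * ((r ^ 2)⁻¹ * e)) := by positivity
  calc |ξ ^ P.d * (d1Kernel ξ⁻¹ μ G0 y y' * g y * G y y' * (g' y' - g' y))|
      ≤ (P.d * B' * B * K * (ξ ^ P.d * ((r ^ 2)⁻¹ * e))) * e := by rw [← hrew]; exact hprod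
    _ ≤ (P.d * B' * B * K * (ξ ^ P.d * ((r ^ 2)⁻¹ * e))) * 1 := mul_le_mul_of_nonneg_left he1 hmain
    _ = _ := by rw [mul_one]

/-- kernel: `|y − y|₁ = 0` on the torus. [folklore] -/
private theorem tdist_self' (y : Site P j) : Site.tdist y y = 0 := by
  simp [Site.tdist]

/-! ## 2. "the expression in the square bracket in (3.23) containing the second term will be convergent" (d = 3) -/

/-- **p. 439 [PDF 29]: "the expression in the square bracket in (3.23) containing the second term will be convergent"**, `d = 3`,
PROVED as a bound by ONE constant: under the printed kernel bounds `|(∂^ξ_μG^ξ_{j″}(0))(y,y′)| ≤ B′e^{−δ|y−y′|}/|y−y′|²`,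
`|G^ξ_{j″}(y,y′)| ≤ Be^{−δ|y−y′|}/|y−y′|` (`y′ ≠ y`; `|y − y′| = ξ|y − y′|_∞`), `|g| ≤ 1` and the Lipschitz reading
`|g′(y′) − g′(y)| ≤ Kξ|y − y′|₁` of the printed `(g′(x′) − g′(x))/|x′−x| · |x′−x|`, the second term of the p. 439 splitting of the
bracket of (3.23) satisfies, for every `y`,
`|Σ_{y′}ξ³(∂^ξ_μG^ξ_{j″}(0))(y,y′)g(y)G^ξ_{j″}(y,y′)(g′(y′) − g′(y))| ≤ 3·B′·B·K·radialConst 3 δ ξ 0` — a constant independent of `y`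
and of the volume. [cite: Balaban1983Higgs3, (3.23) p.439] -/
theorem abs_second323_le (hd : P.d = 3) {ξ : ℝ} (hξ : 0 < ξ) {δ B B' K : ℝ} (hδ : 0 < δ) (hB : 0 ≤ B) (hB' : 0 ≤ B')
    (hK : 0 ≤ K) (G0 G : Kernel P j) (g g' : SiteField P j ℝ) (μ : Fin P.d)
    (hM : ∀ y y' : Site P j, y' ≠ y →
      |d1Kernel ξ⁻¹ μ G0 y y'| ≤ B' * ((ξ * supDist y y') ^ 2)⁻¹ * Real.exp (-(δ * (ξ * supDist y y'))))
    (hG : ∀ y y' : Site P j, y' ≠ y → |G y y'| ≤ B * (ξ * supDist y y')⁻¹ * Real.exp (-(δ * (ξ * supDist y y'))))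
    (hg : ∀ y, |g y| ≤ 1) (hg' : ∀ y y' : Site P j, |g' y' - g' y| ≤ K * (ξ * Site.tdist y y')) (y : Site P j) :
    |∑ y' : Site P j, ξ ^ P.d * (d1Kernel ξ⁻¹ μ G0 y y' * g y * G y y' * (g' y' - g' y))| ≤
      P.d * B' * B * K * radialConst P.d δ ξ 0 := by
  classical
  set F : Site P j → ℝ := fun y' => ξ ^ P.d * (d1Kernel ξ⁻¹ μ G0 y y' * g y * G y y' * (g' y' - g' y)) with hF
  -- the diagonal term vanishes with the difference `g′(y) − g′(y)`
  have hF0 : F y = 0 := by simp only [hF, sub_self, mul_zero]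
  -- off-diagonal per-site bound
  set X2 : Site P j → ℝ := fun y' => ξ ^ P.d * (((ξ * supDist y y') ^ 2)⁻¹ * Real.exp (-(δ * (ξ * supDist y y'))))
    with hX2
  have hterm : ∀ y' ∈ Finset.univ.filter (fun y' : Site P j => y' ≠ y), |F y'| ≤ P.d * B' * B * K * X2 y' := by
    intro y' hy'
    have hne : y' ≠ y := (Finset.mem_filter.mp hy').2
    exact term323_le hξ hδ hB hB' hK G0 G g g' μ y y' hne (hM y y' hne) (hG y y' hne) (hg y) (hg' y y')
  -- the radial sum with the singularity `1/|y−y′|²` (d = 3: κ = 2, p = 0)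
  have hR2 : ∑ y' ∈ Finset.univ.filter (fun y' : Site P j => y' ≠ y), X2 y' ≤ radialConst P.d δ ξ 0 := by
    have h := riemann_radial_sum_le y hδ hξ (κ := 2) (p := 0) (by omega)
    simpa [radialConst, hX2] using h
  have hc0 : 0 ≤ (P.d : ℝ) * B' * B * K := by positivity
  calc |∑ y' : Site P j, ξ ^ P.d * (d1Kernel ξ⁻¹ μ G0 y y' * g y * G y y' * (g' y' - g' y))|
      = |∑ y' : Site P j, F y'| := rfl
    _ ≤ ∑ y' : Site P j, |F y'| := Finset.abs_sum_le_sum_abs _ _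
    _ = ∑ y' ∈ Finset.univ.filter (fun y' : Site P j => y' ≠ y), |F y'| := by
        symm
        refine Finset.sum_subset (Finset.filter_subset _ _) fun y' _ hy' => ?_
        have : y' = y := by
          by_contra h; exact hy' (Finset.mem_filter.mpr ⟨Finset.mem_univ _, h⟩)
        rw [this, hF0, abs_zero]
    _ ≤ ∑ y' ∈ Finset.univ.filter (fun y' : Site P j => y' ≠ y), P.d * B' * B * K * X2 y' := Finset.sum_le_sum hterm
    _ = P.d * B' * B * K * ∑ y' ∈ Finset.univ.filter (fun y' : Site P j => y' ≠ y), X2 y' := by rw [Finset.mul_sum]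
    _ ≤ P.d * B' * B * K * radialConst P.d δ ξ 0 := mul_le_mul_of_nonneg_left hR2 hc0

/-- The same bound with `ξ` replaced by `1` in the constant: for all spacings `0 < ξ ≤ 1` the second term of the split bracket of
(3.23) is bounded by ONE constant `3B′BK·radialConst 3 δ 1 0` — uniformly in `ξ` and in the volume: the printed *"will be
convergent"* (no divergence as `ξ = L^{−j″} → 0`). [cite: Balaban1983Higgs3, (3.23) p.439] -/
theorem abs_second323_le_uniform (hd : P.d = 3) {ξ : ℝ} (hξ : 0 < ξ) (hξ1 : ξ ≤ 1) {δ B B' K : ℝ} (hδ : 0 < δ) (hB : 0 ≤ B)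
    (hB' : 0 ≤ B') (hK : 0 ≤ K) (G0 G : Kernel P j) (g g' : SiteField P j ℝ) (μ : Fin P.d)
    (hM : ∀ y y' : Site P j, y' ≠ y →
      |d1Kernel ξ⁻¹ μ G0 y y'| ≤ B' * ((ξ * supDist y y') ^ 2)⁻¹ * Real.exp (-(δ * (ξ * supDist y y'))))
    (hG : ∀ y y' : Site P j, y' ≠ y → |G y y'| ≤ B * (ξ * supDist y y')⁻¹ * Real.exp (-(δ * (ξ * supDist y y'))))
    (hg : ∀ y, |g y| ≤ 1) (hg' : ∀ y y' : Site P j, |g' y' - g' y| ≤ K * (ξ * Site.tdist y y')) (y : Site P j) :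
    |∑ y' : Site P j, ξ ^ P.d * (d1Kernel ξ⁻¹ μ G0 y y' * g y * G y y' * (g' y' - g' y))| ≤
      P.d * B' * B * K * radialConst P.d δ 1 0 := by
  refine (abs_second323_le hd hξ hδ hB hB' hK G0 G g g' μ hM hG hg hg' y).trans ?_
  have h2 := radialConst_mono P.d hδ hξ1 0
  have hc0 : 0 ≤ (P.d : ℝ) * B' * B * K := by positivity
  exact mul_le_mul_of_nonneg_left h2 hc0

/-- The same statement ON r15's BRACKET: `[(3.23)](y)` minus the printed first term `g(y)g′(y)Σ_{y′}ξ^d(∂^ξ_μG^ξ_{j″}(0))(y,y′)G^ξ_{j″}(y,y′)`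
IS the second term (`bracket323_split`), hence is bounded by the same constant `3B′BK·radialConst 3 δ ξ 0` for every `y`, uniformly
in the volume. [cite: Balaban1983Higgs3, (3.23) p.439] -/
theorem abs_bracket323_sub_first_le (hd : P.d = 3) {ξ : ℝ} (hξ : 0 < ξ) {δ B B' K : ℝ} (hδ : 0 < δ) (hB : 0 ≤ B)
    (hB' : 0 ≤ B') (hK : 0 ≤ K) (G0 G : Kernel P j) (g g' : SiteField P j ℝ) (μ : Fin P.d)
    (hM : ∀ y y' : Site P j, y' ≠ y →
      |d1Kernel ξ⁻¹ μ G0 y y'| ≤ B' * ((ξ * supDist y y') ^ 2)⁻¹ * Real.exp (-(δ * (ξ * supDist y y'))))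
    (hG : ∀ y y' : Site P j, y' ≠ y → |G y y'| ≤ B * (ξ * supDist y y')⁻¹ * Real.exp (-(δ * (ξ * supDist y y'))))
    (hg : ∀ y, |g y| ≤ 1) (hg' : ∀ y y' : Site P j, |g' y' - g' y| ≤ K * (ξ * Site.tdist y y')) (y : Site P j) :
    |bracket323 ξ μ G0 G g g' y -
        g y * g' y * ∑ y' : Site P j, ξ ^ P.d * (d1Kernel ξ⁻¹ μ G0 y y' * G y y')| ≤
      P.d * B' * B * K * radialConst P.d δ ξ 0 := by
  rw [bracket323_split, add_sub_cancel_left]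
  exact abs_second323_le hd hξ hδ hB hB' hK G0 G g g' μ hM hG hg hg' y

/-- Consequently the FULL bracket of (3.23) differs from its first term by at most that constant: `|[(3.23)](y)| ≤ |first term| +
3B′BK·radialConst 3 δ ξ 0` — the p. 439 reduction of the convergence question to the first term (then treated by (3.24)).
[cite: Balaban1983Higgs3, (3.23) p.439] -/
theorem abs_bracket323_le_first_add (hd : P.d = 3) {ξ : ℝ} (hξ : 0 < ξ) {δ B B' K : ℝ} (hδ : 0 < δ) (hB : 0 ≤ B)
    (hB' : 0 ≤ B') (hK : 0 ≤ K) (G0 G : Kernel P j) (g g' : SiteField P j ℝ) (μ : Fin P.d)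
    (hM : ∀ y y' : Site P j, y' ≠ y →
      |d1Kernel ξ⁻¹ μ G0 y y'| ≤ B' * ((ξ * supDist y y') ^ 2)⁻¹ * Real.exp (-(δ * (ξ * supDist y y'))))
    (hG : ∀ y y' : Site P j, y' ≠ y → |G y y'| ≤ B * (ξ * supDist y y')⁻¹ * Real.exp (-(δ * (ξ * supDist y y'))))
    (hg : ∀ y, |g y| ≤ 1) (hg' : ∀ y y' : Site P j, |g' y' - g' y| ≤ K * (ξ * Site.tdist y y')) (y : Site P j) :
    |bracket323 ξ μ G0 G g g' y| ≤
      |g y * g' y * ∑ y' : Site P j, ξ ^ P.d * (d1Kernel ξ⁻¹ μ G0 y y' * G y y')| +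
        P.d * B' * B * K * radialConst P.d δ ξ 0 := by
  have h := abs_bracket323_sub_first_le hd hξ hδ hB hB' hK G0 G g g' μ hM hG hg hg' y
  have htri := abs_sub_abs_le_abs_sub (bracket323 ξ μ G0 G g g' y)
    (g y * g' y * ∑ y' : Site P j, ξ ^ P.d * (d1Kernel ξ⁻¹ μ G0 y y' * G y y'))
  linarith

/-! ## 3. The model instance: both propagators the torus free propagator C^ξ_T (kernel bounds discharged) -/

/-- **p. 439 second-term convergence with BOTH kernel bounds DISCHARGED for the torus free propagator** `C^ξ_T` (the leading term of
the print's replacement `G^ξ_{j″}(0) = C^ξ + G^ξ_{j″}(0)(1 − m²_{j″} − a_{j″}P_{j″})C^ξ`, p. 437): `d = 3`, `0 < ξ ≤ 1`, side `1 ≤ ξN`;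
the derivative bound `|(∂^ξ_μC^ξ_T)(y,y′)| ≤ 3037500·e^{−½|y−y′|}/|y−y′|²` is `abs_d1Kernel_CxiT_le'` and the kernel bound
`|C^ξ_T(y,y′)| ≤ torusConst·e^{−½|y−y′|}/|y−y′|` is p03's `CxiT_hC`; with `|g| ≤ 1` and `g′` Lipschitz (`K`), for every `y`:
`|Σ_{y′}ξ³(∂^ξ_μC^ξ_T)(y,y′)g(y)C^ξ_T(y,y′)(g′(y′) − g′(y))| ≤ 3·3037500·torusConst·K·radialConst 3 ½ ξ 0`, uniformly in the volume.
[cite: Balaban1983Higgs3, (3.23) p.439] -/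
theorem abs_second323_CxiT_le (hd : P.d = 3) {ξ : ℝ} (hξ : 0 < ξ) (hξ1 : ξ ≤ 1) (hN : 1 ≤ ξ * (P.sitesPerDir j : ℝ))
    {K : ℝ} (hK : 0 ≤ K) (g g' : SiteField P j ℝ) (μ : Fin P.d) (hg : ∀ y, |g y| ≤ 1)
    (hg' : ∀ y y' : Site P j, |g' y' - g' y| ≤ K * (ξ * Site.tdist y y')) (y : Site P j) :
    |∑ y' : Site P j, ξ ^ P.d * (d1Kernel ξ⁻¹ μ (CxiT ξ) y y' * g y * CxiT ξ y y' * (g' y' - g' y))| ≤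
      P.d * 3037500 * torusConst * K * radialConst P.d (1 / 2) ξ 0 :=
  abs_second323_le hd hξ (by norm_num) torusConst_nonneg (by norm_num) hK (CxiT ξ) (CxiT ξ) g g' μ
    (fun _ _ hne => abs_d1Kernel_CxiT_le' hd hξ hξ1 hN hne μ) (CxiT_hC hd hξ hξ1 hN) hg hg' y

/-- The same, UNIFORM in the lattice spacing `0 < ξ ≤ 1` (the constant at `ξ = 1`): the p. 439 *"will be convergent"* for the
`C^ξ_T·C^ξ_T` member, with no kernel-bound hypothesis left. [cite: Balaban1983Higgs3, (3.23) p.439] -/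
theorem abs_second323_CxiT_le_uniform (hd : P.d = 3) {ξ : ℝ} (hξ : 0 < ξ) (hξ1 : ξ ≤ 1) (hN : 1 ≤ ξ * (P.sitesPerDir j : ℝ))
    {K : ℝ} (hK : 0 ≤ K) (g g' : SiteField P j ℝ) (μ : Fin P.d) (hg : ∀ y, |g y| ≤ 1)
    (hg' : ∀ y y' : Site P j, |g' y' - g' y| ≤ K * (ξ * Site.tdist y y')) (y : Site P j) :
    |∑ y' : Site P j, ξ ^ P.d * (d1Kernel ξ⁻¹ μ (CxiT ξ) y y' * g y * CxiT ξ y y' * (g' y' - g' y))| ≤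
      P.d * 3037500 * torusConst * K * radialConst P.d (1 / 2) 1 0 :=
  abs_second323_le_uniform hd hξ hξ1 (by norm_num) torusConst_nonneg (by norm_num) hK (CxiT ξ) (CxiT ξ) g g' μ
    (fun _ _ hne => abs_d1Kernel_CxiT_le' hd hξ hξ1 hN hne μ) (CxiT_hC hd hξ hξ1 hN) hg hg' y

/-- The bracket form of the instance: with `G^ξ_{j″}(0) = G^ξ_{j″} = C^ξ_T`, r15's `[(3.23)](y)` minus its first term
`g(y)g′(y)Σ_{y′}ξ³(∂^ξ_μC^ξ_T)(y,y′)C^ξ_T(y,y′)` (the `C^ξC^ξ` sum the print then evaluates by (3.24)) is bounded by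
`3·3037500·torusConst·K·radialConst 3 ½ ξ 0` for every `y`, uniformly in the volume. [cite: Balaban1983Higgs3, (3.23) p.439] -/
theorem abs_bracket323_CxiT_sub_first_le (hd : P.d = 3) {ξ : ℝ} (hξ : 0 < ξ) (hξ1 : ξ ≤ 1)
    (hN : 1 ≤ ξ * (P.sitesPerDir j : ℝ)) {K : ℝ} (hK : 0 ≤ K) (g g' : SiteField P j ℝ) (μ : Fin P.d)
    (hg : ∀ y, |g y| ≤ 1) (hg' : ∀ y y' : Site P j, |g' y' - g' y| ≤ K * (ξ * Site.tdist y y')) (y : Site P j) :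
    |bracket323 ξ μ (CxiT ξ) (CxiT ξ) g g' y -
        g y * g' y * ∑ y' : Site P j, ξ ^ P.d * (d1Kernel ξ⁻¹ μ (CxiT ξ) y y' * CxiT ξ y y')| ≤
      P.d * 3037500 * torusConst * K * radialConst P.d (1 / 2) ξ 0 :=
  abs_bracket323_sub_first_le hd hξ (by norm_num) torusConst_nonneg (by norm_num) hK (CxiT ξ) (CxiT ξ) g g' μ
    (fun _ _ hne => abs_d1Kernel_CxiT_le' hd hξ hξ1 hN hne μ) (CxiT_hC hd hξ hξ1 hN) hg hg' y

end

end Literature.MathematicalPhysics.QuantumFieldTheory.Balaban1983to89.B3Bound323
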